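import Mathlib.Tactic
import HarnessLib

/-!
# Kozma–Nitzan's Question 8 at three relays — (T*) is settled outside the "doubly-bad" regime (scalar skeleton)

Support file (`--supports stmt-CriticalPhenomena-4575`, closed crux; independent mathematics on Kozma–Nitzan's Question 8,
arXiv:2401.12397 §5.5 p. 36), prover `prim-ineq-gen-7` (gen 12).  No definitions, no named facts, no sorries; standard axioms.
Memo `run/shared/lean/prim/prim-ineq-gen-7/FINDING-TSTAR-g12.md` §9; companion of `…KnQuestion8ClaimMReduction.lean` (same dictionary:
atoms `OV, OM, E, PV, PM` of the frame `{x,o} ↮ Y`, masses `m·`, integrals `g· = ∫_atom Ĝ` of an increasing function `Ĝ` of the edge cluster of `{x,o}`).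

The splitting inequality `(SPLIT)  E'[Ĝ|OV] − E'[Ĝ|PM] ≥ θ·(E'[Ĝ|PV] − E'[Ĝ|PM])`, `θ = ν'(O2)π_V/(ν'(OV)π) ≤ 1`, is automatic when
`(D1) E'[Ĝ|PV] ≤ E'[Ĝ|OV]` (by `(D3) E'[Ĝ|OV] ≥ E'[Ĝ|PM]` and `θ ≤ 1`).  Together with the K2b dichotomy of `tstar_of_split_abstract`:
* `PocketCert.tstar_of_doublyBad_abstract` — **(T*) ⟸ (α) ∧ (D2) ∧ (D3) ∧ (c4′) ∧ [K2b ∨ D1 ∨ SPLIT]**: the hypothesis `hS` asks for (SPLIT) ONLY when BOTH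
  `K2b` (`gPM·mE ≥ gE·mPM` fails) AND `D1` (`gPV·mOV ≤ gOV·mPV` fails) fail — the "doubly-bad" regime (exhaustive n ≤ 5: 1.7 % of the instances, (SPLIT)
  holds there with a strictly positive margin, 0 / 85 470).  (α), (D2), (D3), (c4′) are tree theorems (`PocketCert.frameDom_o2_p`, `frameDom_om_pm`,
  `frame_event_dom`/`frame_event_assoc`, `frameCov_ov_o2`).  Route identities: `star = mPM·X_α + mP(mE gPM − mPM gE)`;
  `star = SPLIT + mP(mPM gOM − mOM gPM)`; `mOV·SPLIT = slack·(mPM gOV − mOV gPM) + mO2·mPM·(mPV gOV − mOV gPV)`, `slack = mOV mP − mO2 mPV ≥ 0`.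
[cite: KozmaNitzan2024, Question 8 (§5.5 p. 36)] [cite: VandenbergHaggstromKahn2005, Thm. 2.1 (p. 9)]
-/

namespace Summit.CriticalPhenomena.PercolationContinuityZ3.Theorems

namespace PocketCert

/-- **(T*) outside the doubly-bad regime** — see the module docstring. [cite: KozmaNitzan2024, Question 8 (§5.5 p. 36)] -/
theorem tstar_of_doublyBad_abstract (mOV mOM mE mPV mPM gOV gOM gE gPV gPM : ℝ)
    (hOV : 0 ≤ mOV) (hOM : 0 ≤ mOM) (hE : 0 ≤ mE) (hPV : 0 ≤ mPV) (hPM : 0 ≤ mPM)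
    (hgOV : mOV = 0 → gOV = 0) (hgPV : mPV = 0 → gPV = 0)
    (hα : (mOV + mOM + mE) * (gPV + gPM) ≤ (mPV + mPM) * (gOV + gOM + gE))
    (hD2 : gPM * mOM ≤ gOM * mPM) (hD3 : gPM * mOV ≤ gOV * mPM)
    (hc4 : (mOV + mOM + mE) * mPV ≤ (mPV + mPM) * mOV)
    (hS : gPM * mE < gE * mPM → gOV * mPV < gPV * mOV →
      0 ≤ (mPV + mPM) * mPM * gOV - (mOV + mOM + mE) * mPM * gPV - (mOV * (mPV + mPM) - (mOV + mOM + mE) * mPV) * gPM) :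
    0 ≤ mPM * ((mPV + mPM) * (gOV + gOM) - (mOV + mOM) * (gPV + gPM)) - mE * (mPM * (gPV + gPM) - (mPV + mPM) * gPM) := by
  set P := mPV + mPM with hP
  set O2 := mOV + mOM + mE with hO2
  have hP0 : 0 ≤ P := by rw [hP]; linarith
  have hO20 : 0 ≤ O2 := by rw [hO2]; linarith
  set Xα := P * (gOV + gOM + gE) - O2 * (gPV + gPM) with hXα
  have hXα0 : 0 ≤ Xα := by rw [hXα]; linarith
  set slack := mOV * P - O2 * mPV with hslack
  have hslack0 : 0 ≤ slack := by rw [hslack]; linarith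
  set SPLIT := P * mPM * gOV - O2 * mPM * gPV - (mOV * P - O2 * mPV) * gPM with hSPLIT
  have id1 : mPM * (P * (gOV + gOM) - (mOV + mOM) * (gPV + gPM)) - mE * (mPM * (gPV + gPM) - P * gPM) =
      mPM * Xα + P * (mE * gPM - mPM * gE) := by
    rw [hXα, hO2]; ring
  have id2 : mPM * (P * (gOV + gOM) - (mOV + mOM) * (gPV + gPM)) - mE * (mPM * (gPV + gPM) - P * gPM) =
      SPLIT + P * (mPM * gOM - mOM * gPM) := by
    rw [hSPLIT, hO2, hP]; ring
  have id3 : mOV * SPLIT = slack * (mPM * gOV - mOV * gPM) + O2 * mPM * (mPV * gOV - mOV * gPV) := by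
    rw [hSPLIT, hslack]; ring
  have hD2' : 0 ≤ P * (mPM * gOM - mOM * gPM) := mul_nonneg hP0 (by linarith)
  -- it suffices to get SPLIT ≥ 0 once K2b fails
  have key : gPM * mE < gE * mPM → 0 ≤ SPLIT := by
    intro hK
    by_cases hD1 : gOV * mPV < gPV * mOV
    · -- doubly bad: the hypothesis
      have h := hS hK hD1
      rw [hSPLIT, hP, hO2]; exact h
    · -- D1 holds: SPLIT from D3, D1 and slack ≥ 0
      rw [not_lt] at hD1
      have hOS : 0 ≤ mOV * SPLIT := by
        rw [id3]
        have t1 : 0 ≤ slack * (mPM * gOV - mOV * gPM) := mul_nonneg hslack0 (by linarith)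
        have t2 : 0 ≤ O2 * mPM * (mPV * gOV - mOV * gPV) := mul_nonneg (mul_nonneg hO20 hPM) (by linarith)
        linarith
      rcases eq_or_lt_of_le hOV with hOV0 | hOVpos
      · -- mOV = 0: then gOV = 0 and O2·mPV = 0
        have hg : gOV = 0 := hgOV hOV0.symm
        have h02 : O2 * mPV = 0 := by
          apply le_antisymm _ (mul_nonneg hO20 hPV)
          have : O2 * mPV ≤ P * mOV := hc4
          rw [← hOV0, mul_zero] at this
          exact this
        rcases mul_eq_zero.1 h02 with hO2z | hPVz
        · rw [hSPLIT, hg, ← hOV0, hO2z]; ring_nf; exact le_rfl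
        · have hgPV0 : gPV = 0 := hgPV hPVz
          rw [hSPLIT, hg, ← hOV0, hgPV0, hPVz]; ring_nf; exact le_rfl
      · by_contra hneg
        rw [not_le] at hneg
        have : mOV * SPLIT < 0 := mul_neg_of_pos_of_neg hOVpos hneg
        linarith
  by_cases hK : gE * mPM ≤ gPM * mE
  · rw [id1]
    have h1 : 0 ≤ mPM * Xα := mul_nonneg hPM hXα0
    have h2 : 0 ≤ P * (mE * gPM - mPM * gE) := mul_nonneg hP0 (by linarith)
    linarith
  · rw [not_le] at hK
    have hS0 := key (by linarith)
    rw [id2]; linarith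

end PocketCert

end Summit.CriticalPhenomena.PercolationContinuityZ3.Theorems
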